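import Summits.HodgeConjecture.HodgeConjecture.Theorems.MarkmanPartnerTransportPicardThreeK3SquaresRMTypeOpenSubtypeByName
import Summits.HodgeConjecture.HodgeConjecture.Theorems.MarkmanPartnerTransportPicardThreeK3SquaresOneCycleHodge
import HarnessLib

/-!
# Route MarkmanPartnerTransport · crux `PicardThreeK3Squares` (stmt-HodgeConjecture-19652) —
# THE TRANSPORTED CYCLE as a standalone lemma, and (T⁗-ρ): the period alone suffices at every Picard number
# `ρ(S) ∉ {2, 4, 6, 10}`

Cell hodge-nonav, crux #4 (HC⁴(S ⊗ S), ρ(S) ≥ 3; open core: real multiplication), programme «RATIONAL ORBIT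
DENSITY» continued (prover seat hodge-nonav-19652-p1 gen 20; `--supports stmt-HodgeConjecture-19652`,
helper). Sequel to `…RMTypeOpenSubtypeOddPicard` ((T⁗-odd)). CONDITIONAL on the named facts
`Buskin2019_hodgeIsometry_algebraic`, `Huybrechts_K3_marking_exists` and a DISPLAYED strong open input;
credits nothing; nothing here says HC is proved.

* **`exists_oneCycle_of_openAll` — THE TRANSPORTED CYCLE.** For `θ` self-adjoint with an eigenprojector
  certificate at the real eigenvalue `e ≠ 0`, the strong open input `OpenAll[θ, e]`, and a marked projective
  K3 surface `(S, η, p, x)` whose period is carried by a rational isometry `σ` of `Λ_ℚ` onto the Hodge locus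
  (`θ_ℂ(σx) = e·σx`): there is an endomorphism `Θ` of `H²(S(ℂ); ℂ)` which is RATIONAL, TYPE-PRESERVING,
  INDUCED BY AN ALGEBRAIC CLASS on `S × S`, and has the period as an eigenvector, `Θ(η⁻¹x) = e·η⁻¹x`
  (`Θ = η⁻¹(gσ)⁻¹θ_ℂ(gσ)η` for the `g ∈ G_θ(ℚ)` of orbit density; Buskin both ways + composition). This is the
  common core of (T⁗), (T⁗-odd) and (T⁗-ρ), exported for further consumers (it is the «one cycle» of gen 8's
  ONE-CYCLE theorems, produced from the period position alone).
* **`hodgeConjectureFor_square_of_openAll_of_picard` — (T⁗-ρ)**: if moreover `e ∉ ℚ` and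
  `ρ(S) ∉ {2, 4, 6, 10}`, then `HodgeConjectureFor 4 (S ⊗ S)` (`OneCycle.hodgeConjectureFor_square_of_oneCycle_of_picard`:
  generation-or-CM from the degree law, CM branch by Buskin). Covers (T⁗-odd) (odd `ρ`) and the even Picard
  numbers `8, 12, 14, 16, …` — e.g. every point of Picard number `12`, `14` or `16` of the `√2` locus.
* `hodgeConjectureFor_square_of_openAll_of_picard_of_separable` — the certificate and the irrationality
  bookkeeping from a separable model polynomial `P` with `θ_ℂ·P(θ_ℂ) = 0` and no rational root.

No definition, no sorry, no new named fact. References: van Geemen–Schütt, Forum Math. Sigma 13 (2025) e2,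
§2.1, §3.4, §4.8, §6.6; van Geemen, Michigan Math. J. 56 (2008) Lemma 3.2; Buskin, J. reine angew. Math. 755
(2019), Thm. 1.1, §6.2; Varesco, Math. Z. 305 (2023) §2; Huybrechts, *Lectures on K3 Surfaces*, Ch. 3
Cor. 3.6, Ch. 6 Prop. 1.2/1.5.
-/

set_option linter.dupNamespace false

noncomputable section

namespace Summit.HodgeConjecture.HodgeConjecture.Theorems.MarkmanPartnerTransport.RMTypeOrbit

open CategoryTheory MonoidalCategory Polynomial
open Literature.AlgebraicGeometry Literature.AlgebraicGeometry.Motives Literature.AlgebraicGeometry.HodgeTheory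
open Literature.AlgebraicGeometry.Surfaces Literature.LinearAlgebra.QuadraticForm
open Literature.AlgebraicTopology.SingularHomology
open Summit.HodgeConjecture.HodgeConjecture.Theorems.NikulinTwinTransport
open Summit.HodgeConjecture.HodgeConjecture.Theorems.MarkmanPartnerTransport.IsogenyInvariance
open Summit.HodgeConjecture.HodgeConjecture.Theorems.MarkmanPartnerTransport.RMTypeDescent

/-- `MarkedK3[S, η, p, x]`: VERBATIM the `let MarkedK3 := …` binder of the route declaration
`PicardThreeK3Squares` (as in `…RMTypeDescent`). Local notation only. -/
local notation3 (prettyPrint := false) "MarkedK3[" S ", " η ", " p ", " x "]" =>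
  (p ≠ 0 ∧ (IsIntegralClass p ∧
    (∀ q : complexBetti S (2 * 2), IsIntegralClass q → ∃ n : ℤ, q = n • p) ∧
    (∀ c : complexBetti S (2 * 1), IsIntegralClass c ↔ ∃ v : K3Index → ℤ, η c = fun i => (v i : ℂ)) ∧
    (∀ a b : complexBetti S (2 * 1),
      cupProduct (rfl : 2 * 1 + 2 * 1 = 2 * 2) a b = k3Form (η a) (η b) • p) ∧
    IsOfHodgeType 2 S (2 * 1) 2 0 (LinearEquiv.symm η x) ∧
    (∀ τ : complexBetti S (2 * 1), IsOfHodgeType 2 S (2 * 1) 2 0 τ →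
      ∃ t : ℂ, τ = t • LinearEquiv.symm η x)) ∧
    (k3Form x x = 0 ∧ 0 < (k3Form (star x) x).re ∧
      ∃ u : K3Index → ℤ, k3Form (fun i => (u i : ℂ)) x = 0 ∧ 0 < ∑ i, ∑ j, u i * k3Gram i j * u j))

variable {S : SchemeOver ℂ}

/-- `CycleAll[θ, e, U]`: the STRONG ∃-form open-set input — at EVERY period point of `D_{θ,e}` in `U`
(`θ`-generic OR NOT) there is a marked projective K3 surface carrying an algebraic class inducing
`η'⁻¹ θ_ℂ η'`. (`CycleEx[θ, e, U]` of `…RMTypeOpenExists` is the same clause restricted to `θ`-generic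
periods.) Local notation only. -/
local notation3 (prettyPrint := false) "CycleAll[" θ ", " e ", " U "]" =>
  (∀ y : K3Index → ℂ, y ∈ U → thetaC θ y = (e : ℂ) • y → k3Form y y = 0 → 0 < (k3Form (star y) y).re →
    ∃ (S' : SchemeOver ℂ) (hS' : IsK3Surface S') (η' : complexBetti S' (2 * 1) ≃ₗ[ℂ] (K3Index → ℂ))
      (p' : complexBetti S' (2 * 2)), MarkedK3[S', η', p', y] ∧
      ∃ γ' ∈ algebraicClasses (S' ⊗ S') 2, ∀ z : complexBetti S' (2 * 1),
        (η'.symm.toLinearMap ∘ₗ (thetaC θ ∘ₗ η'.toLinearMap)) z =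
          complexGysin complexOrientationFamily
            (IsSmoothProjective.tensor_holds hS'.isSmoothProjective hS'.isSmoothProjective)
            hS'.isSmoothProjective (SemiCartesianMonoidalCategory.fst S' S')
            (rfl : 2 * 1 + 2 * 2 + 2 * 2 = 2 * 1 + 2 * (2 + 2))
            (cupProduct (rfl : 2 * 1 + 2 * 2 = 2 * 1 + 2 * 2)
              (complexBetti.map (SemiCartesianMonoidalCategory.snd S' S') (2 * 1) z) γ'))

/-- `OpenAll[θ, e]`: there is an open `U ⊂ Λ_ℂ` containing a `θ`-GENERIC period point of `D_{θ,e}` on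
which `CycleAll[θ, e, U]` holds. Local notation only. -/
local notation3 (prettyPrint := false) "OpenAll[" θ ", " e "]" =>
  (∃ U : Set (K3Index → ℂ), IsOpen U ∧
    (∃ y₁ ∈ U, thetaC θ y₁ = (e : ℂ) • y₁ ∧ k3Form y₁ y₁ = 0 ∧ 0 < (k3Form (star y₁) y₁).re ∧
      ∀ v : K3Index → ℚ, k3Form (fun i => (v i : ℂ)) y₁ = 0 → Matrix.mulVec θ v = 0) ∧
    CycleAll[θ, e, U])

/-- `Corr[hS ; γ, y] = fst_*(snd^* y ∪ γ)` on `H²(S(ℂ); ℂ)` at the complex orientation family. Local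
notation only. -/
local notation3 (prettyPrint := false) "Corr[" hS " ; " γ ", " y "]" =>
  complexGysin complexOrientationFamily (IsSmoothProjective.tensor_holds hS hS) hS
    (SemiCartesianMonoidalCategory.fst _ _) (rfl : 2 * 1 + 2 * 2 + 2 * 2 = 2 * 1 + 2 * (2 + 2))
    (cupProduct (rfl : 2 * 1 + 2 * 2 = 2 * 1 + 2 * 2)
      (complexBetti.map (SemiCartesianMonoidalCategory.snd _ _) (2 * 1) y) γ)

/-! ### The transported cycle -/

/-- **THE TRANSPORTED CYCLE.** For `θ ∈ M₂₂(ℚ)` `k3Form`-self-adjoint with an eigenprojector certificate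
`π` at the real eigenvalue `e ≠ 0`, the strong open input `OpenAll[θ, e]`, and a marked projective K3
surface `(S, η, p, x)` whose period is carried by a rational isometry `σ` of `Λ_ℚ` onto the Hodge locus
(`θ_ℂ(σx) = e·σx`), there is an endomorphism `Θ` of `H²(S(ℂ); ℂ)` that is rational, preserves the Hodge
types, is induced by an algebraic class on `S × S` (complex orientations), and satisfies
`Θ(η⁻¹x) = e·η⁻¹x`. Construction: orbit density (`exists_ratIsometry_commute_smul_mem_of_isOpen`; positive
kernel vector from the generic witness) gives `g ∈ G_θ(ℚ)`, `c ≠ 0` with `c·gσx ∈ U`; the input gives a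
marked `S'` there with an algebraic `γ'` inducing `η'⁻¹θ_ℂη'`; Buskin for `η'⁻¹gση` and its inverse and
composition (`corrComp_K3_of_cup`) make `Θ := η⁻¹(gσ)⁻¹θ_ℂ(gσ)η` cycle-induced; it is rational, and
type-preserving because it is cup-self-adjoint, real, and has the period as an eigenvector. CONDITIONAL
on `Buskin2019_hodgeIsometry_algebraic` and the displayed input; credits nothing.
[cite: GeemenSchutt2023, §3.4 and §4.8] [cite: Buskin2019, Thm. 1.1 and §6.2 Lemma 6.3]
[cite: Huybrechts2016K3, Ch. 6 Prop. 1.2 and Prop. 1.5] [cite: Omeara1963, §42–§43B] -/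
theorem exists_oneCycle_of_openAll
    (hB : Buskin2019_hodgeIsometry_algebraic)
    {θ : Matrix K3Index K3Index ℚ}
    (hθsa : ∀ a b : K3Index → ℂ, k3Form (thetaC θ a) b = k3Form a (thetaC θ b))
    {e : ℝ} (he : e ≠ 0) {π : ℂ[X]} (hπe : π.eval (e : ℂ) = 1)
    (hπW : ∀ y : K3Index → ℂ,
      thetaC θ (aeval (thetaC θ) π (thetaC θ y)) = (e : ℂ) • aeval (thetaC θ) π (thetaC θ y))
    (hOpen : OpenAll[θ, e])
    (hS : IsK3Surface S)
    (η : complexBetti S (2 * 1) ≃ₗ[ℂ] (K3Index → ℂ)) (p : complexBetti S (2 * 2)) (x : K3Index → ℂ)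
    (hM : MarkedK3[S, η, p, x])
    (σ : Module.End ℂ (K3Index → ℂ)) (hσ : ∀ a b, k3Form (σ a) (σ b) = k3Form a b)
    (hσrat : ∀ v : K3Index → ℤ, ∃ w : K3Index → ℚ, σ (fun i => (v i : ℂ)) = fun i => (w i : ℂ))
    (heig : thetaC θ (σ x) = (e : ℂ) • σ x) :
    ∃ Θ : complexBetti S (2 * 1) →ₗ[ℂ] complexBetti S (2 * 1),
      (∀ y, IsRationalClass y → IsRationalClass (Θ y)) ∧
      (∀ (i j : ℕ) (y : complexBetti S (2 * 1)),
        IsOfHodgeType 2 S (2 * 1) i j y → IsOfHodgeType 2 S (2 * 1) i j (Θ y)) ∧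
      (∃ γ ∈ algebraicClasses (S ⊗ S) 2, ∀ y : complexBetti S (2 * 1),
        Θ y = Corr[hS.isSmoothProjective ; γ, y]) ∧
      Θ (η.symm x) = (e : ℂ) • η.symm x := by
  classical
  have hHT : Huybrechts_K3_hodgeTypes_H2 := Huybrechts_K3_hodgeTypes_H2_holds
  have h4 : 2 * 1 + 2 * 1 = 2 * 2 := rfl
  have hS2 : IsSmoothProjective 2 S := hS.isSmoothProjective
  obtain ⟨hp0, ⟨hpint, hpgen, hηint, hηcup, h20, hline⟩, hPer⟩ := hM
  have hxpos : 0 < (k3Form (star x) x).re := hPer.2.1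
  have hx0 : η.symm x ≠ 0 := fun h0 =>
    ne_zero_of_star_self_re_pos hxpos (by simpa using congrArg η h0)
  -- (c) a positive rational vector killed by `θ`, from the generic witness
  have hw : ∃ w : K3Index → ℚ, θ.mulVec w = 0 ∧ 0 < k3FormRat w w := exists_posKernel_of_openAll hOpen
  obtain ⟨U, hU, ⟨y₁, hy₁U, hy₁, h₁₁, h₁p, -⟩, hcyc⟩ := hOpen
  -- RATIONAL ORBIT DENSITY: move the period into `U` inside the isogeny class
  have hPσ := periodPt_ratIsometry σ hσ hσrat hPer
  obtain ⟨g, c, hc0, hgiso, hgrat, hgcomm, hgU⟩ := exists_ratIsometry_commute_smul_mem_of_isOpen hθsa he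
    hπe hπW hw heig hPσ.1 hPσ.2.1 hU hy₁U hy₁ h₁₁ h₁p
  set σ₁ : Module.End ℂ (K3Index → ℂ) := g ∘ₗ σ with hσ₁def
  have hσ₁ : ∀ a b, k3Form (σ₁ a) (σ₁ b) = k3Form a b := fun a b => by
    rw [hσ₁def, LinearMap.comp_apply, LinearMap.comp_apply, hgiso, hσ]
  have hσ₁rat : ∀ v : K3Index → ℤ, ∃ w : K3Index → ℚ, σ₁ (fun i => (v i : ℂ)) = fun i => (w i : ℂ) := by
    intro v
    obtain ⟨w₁, hw₁⟩ := hσrat v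
    obtain ⟨w₂, hw₂⟩ := ratEnd_ratCast g hgrat w₁
    exact ⟨w₂, by rw [hσ₁def, LinearMap.comp_apply, hw₁, hw₂]⟩
  have heigσ₁ : thetaC θ (σ₁ x) = (e : ℂ) • σ₁ x := by
    have hgx := LinearMap.congr_fun hgcomm (σ x)
    simp only [LinearMap.comp_apply] at hgx
    rw [hσ₁def, LinearMap.comp_apply, ← hgx, heig, map_smul]
  have heig₁ : thetaC θ (c • σ₁ x) = (e : ℂ) • (c • σ₁ x) := by
    rw [map_smul, heigσ₁, smul_comm]
  -- (d) the displayed input: a marked projective K3 surface AT the period `c • σ₁ x ∈ U` with the cycle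
  have hPσ₁ := periodPt_ratIsometry σ₁ hσ₁ hσ₁rat hPer
  have hcσ₁U : c • σ₁ x ∈ U := by rw [hσ₁def, LinearMap.comp_apply]; exact hgU
  have hcc : k3Form (c • σ₁ x) (c • σ₁ x) = 0 := by
    rw [k3Form_smul_left, k3Form_smul_right, hPσ₁.1, mul_zero, mul_zero]
  have hx'pos : 0 < (k3Form (star (c • σ₁ x)) (c • σ₁ x)).re := by
    have hcc' : star c * c = ((‖c‖ ^ 2 : ℝ) : ℂ) := by
      rw [Complex.star_def, Complex.conj_mul', Complex.ofReal_pow]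
    rw [star_smul, k3Form_smul_left, k3Form_smul_right, ← mul_assoc, hcc', Complex.re_ofReal_mul]
    exact mul_pos (pow_pos (norm_pos_iff.2 hc0) 2) hPσ₁.2.1
  obtain ⟨S', hS', η', p', hM'', γ', hγ'alg, hγ'⟩ := hcyc (c • σ₁ x) hcσ₁U heig₁ hcc hx'pos
  obtain ⟨hp'0, ⟨hp'int, hp'gen, hη'int, hη'cup, h20', hline'⟩, hPer'⟩ := hM''
  -- (e) Buskin for `ψ = η'⁻¹ σ₁ η` and `φ = η⁻¹ σ₁⁻¹ η'`
  obtain ⟨σ₁', hσσ₁', hσ₁'σ, hσ₁', hσ₁'rat⟩ := exists_inverse_ratIsometry σ₁ hσ₁ hσ₁rat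
  have hμ : complexOrientationFamily.HasPoincareDuality := OrientationFamily.hasPoincareDuality _
  have hσ1 : ∀ a b, k3Form (σ₁ a) (σ₁ b) = 1 * k3Form a b := fun a b => by rw [hσ₁, one_mul]
  have hσ'1 : ∀ a b, k3Form (σ₁' a) (σ₁' b) = 1 * k3Form a b := fun a b => by rw [hσ₁', one_mul]
  obtain ⟨γψ, hγψ, hψeq⟩ := hB complexOrientationFamily hμ S' S hS' hS p' p ⟨hp'int, hp'gen⟩ ⟨hpint, hpgen⟩
    (η'.symm.toLinearMap ∘ₗ σ₁ ∘ₗ η.toLinearMap)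
    (fun y hy => by
      simp only [LinearMap.comp_apply, LinearEquiv.coe_coe]
      exact isRationalClass_markingConj η' η σ₁ hS' hS hη'int hηint hσ₁rat hy)
    (fun i j y hy => by
      simp only [LinearMap.comp_apply, LinearEquiv.coe_coe]
      exact isOfHodgeType_markingConj η' p' (c • σ₁ x) η p x σ₁ hHT hS' hS hη'int hη'cup h20' hx'pos hηint
        hηcup hp0 h20 hxpos hσ₁rat one_ne_zero hσ1 ⟨c⁻¹, by rw [smul_smul, inv_mul_cancel₀ hc0, one_smul]⟩
        i j y hy)
    (fun a b d hd => by
      simp only [LinearMap.comp_apply, LinearEquiv.coe_coe]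
      have h1 := cupProduct_markingConj η' p' η p σ₁ hp0 hη'cup hηcup hσ1 a b d hd
      rwa [one_mul] at h1)
  obtain ⟨γφ, hγφ, hφeq⟩ := hB complexOrientationFamily hμ S S' hS hS' p p' ⟨hpint, hpgen⟩ ⟨hp'int, hp'gen⟩
    (η.symm.toLinearMap ∘ₗ σ₁' ∘ₗ η'.toLinearMap)
    (fun y hy => by
      simp only [LinearMap.comp_apply, LinearEquiv.coe_coe]
      exact isRationalClass_markingConj η η' σ₁' hS hS' hηint hη'int hσ₁'rat hy)
    (fun i j y hy => by
      simp only [LinearMap.comp_apply, LinearEquiv.coe_coe]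
      exact isOfHodgeType_markingConj η p x η' p' (c • σ₁ x) σ₁' hHT hS hS' hηint hηcup h20 hxpos hη'int
        hη'cup hp'0 h20' hx'pos hσ₁'rat one_ne_zero hσ'1 ⟨c, by rw [map_smul, hσ₁'σ]⟩ i j y hy)
    (fun a b d hd => by
      simp only [LinearMap.comp_apply, LinearEquiv.coe_coe]
      have h1 := cupProduct_markingConj η p η' p' σ₁' hp'0 hηcup hη'cup hσ'1 a b d hd
      rwa [one_mul] at h1)
  -- (f) compose the three correspondences: `Θ = φ ∘ [γ']_* ∘ ψ` is cycle-induced on `S`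
  have hCUP := SquareOfGenerator.cupProduct_mem_algebraicClasses_tripleProduct
  obtain ⟨γ₁, hγ₁, hγ₁eq⟩ := corrComp_K3_of_cup complexOrientationFamily hCUP S' S' S hS' hS' hS γ' hγ'alg γψ hγψ
  obtain ⟨γ₂, hγ₂, hγ₂eq⟩ := corrComp_K3_of_cup complexOrientationFamily hCUP S S' S hS hS' hS γφ hγφ γ₁ hγ₁
  set R : Module.End ℂ (K3Index → ℂ) := σ₁' ∘ₗ thetaC θ ∘ₗ σ₁ with hRdef
  set Θ : complexBetti S (2 * 1) →ₗ[ℂ] complexBetti S (2 * 1) :=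
    η.symm.toLinearMap ∘ₗ R ∘ₗ η.toLinearMap with hΘdef
  have hRapply : ∀ v, R v = σ₁' (thetaC θ (σ₁ v)) := fun v => by
    simp only [hRdef, LinearMap.comp_apply]
  have hΘapply : ∀ y, Θ y = η.symm (σ₁' (thetaC θ (σ₁ (η y)))) := fun y => by
    simp only [hΘdef, hRdef, LinearMap.comp_apply, LinearEquiv.coe_coe]
  have hΘcorr : ∀ y, Θ y = Corr[hS2 ; γ₂, y] := by
    intro y
    have key : Θ y = (η.symm.toLinearMap ∘ₗ σ₁' ∘ₗ η'.toLinearMap)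
        ((η'.symm.toLinearMap ∘ₗ (thetaC θ ∘ₗ η'.toLinearMap))
          ((η'.symm.toLinearMap ∘ₗ σ₁ ∘ₗ η.toLinearMap) y)) := by
      simp only [hΘapply, LinearMap.comp_apply, LinearEquiv.coe_coe, LinearEquiv.apply_symm_apply]
    rw [key, hφeq, hγ', hψeq, ← hγ₁eq, ← hγ₂eq]
  -- (g) `Θ` is rational
  have hRrat : ∀ v : K3Index → ℤ, ∃ w : K3Index → ℚ, R (fun i => (v i : ℂ)) = fun i => (w i : ℂ) := by
    intro v
    obtain ⟨w₁, hw₁⟩ := hσ₁rat v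
    obtain ⟨w₂, hw₂⟩ := ratEnd_ratCast σ₁' hσ₁'rat (θ.mulVec w₁)
    refine ⟨w₂, ?_⟩
    rw [hRdef, LinearMap.comp_apply, LinearMap.comp_apply, hw₁, thetaC_ratCast, hw₂]
  have hΘrat : ∀ y, IsRationalClass y → IsRationalClass (Θ y) := by
    intro y hy
    rw [hΘapply]
    exact isRationalClass_markingConj η η R hS hS hηint hηint hRrat hy
  -- (h) `R` is self-adjoint and real, with `R x = e x`
  have hRsa : ∀ a b : K3Index → ℂ, k3Form (R a) b = k3Form a (R b) := by
    intro a b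
    calc k3Form (R a) b = k3Form (σ₁ (σ₁' (thetaC θ (σ₁ a)))) (σ₁ b) := by rw [hRapply, hσ₁]
      _ = k3Form (σ₁ a) (thetaC θ (σ₁ b)) := by rw [hσσ₁', hθsa]
      _ = k3Form (σ₁ (σ₁' (σ₁ a))) (σ₁ (σ₁' (thetaC θ (σ₁ b)))) := by rw [hσ₁'σ, hσσ₁']
      _ = k3Form a (R b) := by rw [hσ₁, hσ₁'σ, ← hRapply]
  have hRx : R x = (e : ℂ) • x := by
    rw [hRapply, heigσ₁, map_smul, hσ₁'σ]
  have hRstar : ∀ z, R (star z) = star (R z) := fun z => ratEnd_star R hRrat z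
  have hereal : star (e : ℂ) = e := Complex.conj_ofReal e
  -- (i) `Θ` preserves the Hodge types
  have hΘtyp : ∀ (i j : ℕ) (y : complexBetti S (2 * 1)),
      IsOfHodgeType 2 S (2 * 1) i j y → IsOfHodgeType 2 S (2 * 1) i j (Θ y) := by
    obtain ⟨h1, h2, h3⟩ := hHT S hS (η.symm x) h20 hx0
    intro i j y hy
    by_cases hij : i + j = 2 * 1
    · obtain ⟨rfl, rfl⟩ | ⟨rfl, rfl⟩ | ⟨rfl, rfl⟩ :
          (i = 2 ∧ j = 0) ∨ (i = 0 ∧ j = 2) ∨ (i = 1 ∧ j = 1) := by omega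
      · obtain ⟨t', rfl⟩ := (h1 y).1 hy
        refine (h1 _).2 ⟨t' * e, ?_⟩
        rw [map_smul, hΘapply, LinearEquiv.apply_symm_apply, ← hRapply, hRx, map_smul, smul_smul]
      · obtain ⟨t', rfl⟩ := (h2 y).1 hy
        refine (h2 _).2 ⟨t' * star (e : ℂ), ?_⟩
        rw [map_smul, conjClass_marking_symm η hηint, hΘapply, LinearEquiv.apply_symm_apply, ← hRapply,
          hRstar, hRx, star_smul, map_smul, smul_smul]
      · obtain ⟨hc1, hc2⟩ := (h3 y).1 hy
        have hk1 : k3Form (η y) x = 0 := by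
          rw [hηcup, LinearEquiv.apply_symm_apply, smul_eq_zero] at hc1
          exact hc1.resolve_right hp0
        have hk2 : k3Form (η y) (star x) = 0 := by
          rw [conjClass_marking_symm η hηint, hηcup, LinearEquiv.apply_symm_apply, smul_eq_zero] at hc2
          exact hc2.resolve_right hp0
        refine (h3 _).2 ⟨?_, ?_⟩
        · rw [hΘapply, hηcup, LinearEquiv.apply_symm_apply, LinearEquiv.apply_symm_apply, ← hRapply, hRsa,
            hRx, k3Form_smul_right, hk1, mul_zero, zero_smul]
        · rw [conjClass_marking_symm η hηint, hΘapply, hηcup, LinearEquiv.apply_symm_apply,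
            LinearEquiv.apply_symm_apply, ← hRapply, hRsa, hRstar, hRx, star_smul, hereal, k3Form_smul_right,
            hk2, mul_zero, zero_smul]
    · obtain rfl := isOfHodgeType_eq_zero_of_add_ne hy hij
      rw [map_zero]
      obtain ⟨A⟩ := hS.nonempty_hodgeModel
      exact IsOfHodgeType.zero A _ _ _
  -- (j) the period is an eigenvector of `Θ` with the irrational eigenvalue `e`
  have hΘx : Θ (η.symm x) = (e : ℂ) • η.symm x := by
    rw [hΘapply, LinearEquiv.apply_symm_apply, ← hRapply, hRx, map_smul]
  exact ⟨Θ, hΘrat, hΘtyp, ⟨γ₂, hγ₂, hΘcorr⟩, hΘx⟩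

/-! ### (T⁗-ρ): the period alone at `ρ(S) ∉ {2, 4, 6, 10}` -/

/-- **(T⁗-ρ) THE PERIOD ALONE SUFFICES AT `ρ(S) ∉ {2, 4, 6, 10}`.** `θ` self-adjoint with an eigenprojector
certificate at the IRRATIONAL real eigenvalue `e`; `OpenAll[θ, e]`; `(S, η, p, x)` a marked projective K3
surface with `ρ(S) ∉ {2, 4, 6, 10}` whose period is carried by a rational isometry `σ` of `Λ_ℚ` onto the
Hodge locus (`θ_ℂ(σx) = e·σx`) ⟹ `HodgeConjectureFor 4 (S ⊗ S)`: the transported cycle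
(`exists_oneCycle_of_openAll`) is ONE rational type-preserving cycle-induced endomorphism with an
irrational `(2,0)`-eigenvalue, which suffices at these Picard numbers
(`OneCycle.hodgeConjectureFor_square_of_oneCycle_of_picard`: every factorisation `22 − ρ = d·m`, `m ≥ 3`,
has `d` prime, so it generates `End_Hdg T(S)` unless `S` is CM, where Buskin's theorem applies). No
endomorphism, polynomial, generation or conjugation hypothesis on `S`. CONDITIONAL on
`Buskin2019_hodgeIsometry_algebraic`, `Huybrechts_K3_marking_exists` and the displayed input; credits
nothing; HC is NOT proved here. [cite: GeemenSchutt2023, §2.1, §3.4, §4.8 and §6.6]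
[cite: VanGeemen2008RM, Lemma 3.2] [cite: Buskin2019, Thm. 1.1] [cite: Varesco2023, §2 (p. 8)] -/
theorem hodgeConjectureFor_square_of_openAll_of_picard
    (hB : Buskin2019_hodgeIsometry_algebraic) (hmark : Huybrechts_K3_marking_exists)
    {θ : Matrix K3Index K3Index ℚ}
    (hθsa : ∀ a b : K3Index → ℂ, k3Form (thetaC θ a) b = k3Form a (thetaC θ b))
    {e : ℝ} (hirr : ∀ a : ℚ, (a : ℂ) ≠ (e : ℂ)) {π : ℂ[X]} (hπe : π.eval (e : ℂ) = 1)
    (hπW : ∀ y : K3Index → ℂ,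
      thetaC θ (aeval (thetaC θ) π (thetaC θ y)) = (e : ℂ) • aeval (thetaC θ) π (thetaC θ y))
    (hOpen : OpenAll[θ, e])
    (hS : IsK3Surface S)
    (h2 : Module.finrank ℂ ↥(algebraicClasses S 1) ≠ 2) (h4 : Module.finrank ℂ ↥(algebraicClasses S 1) ≠ 4)
    (h6 : Module.finrank ℂ ↥(algebraicClasses S 1) ≠ 6) (h10 : Module.finrank ℂ ↥(algebraicClasses S 1) ≠ 10)
    (η : complexBetti S (2 * 1) ≃ₗ[ℂ] (K3Index → ℂ)) (p : complexBetti S (2 * 2)) (x : K3Index → ℂ)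
    (hM : MarkedK3[S, η, p, x])
    (σ : Module.End ℂ (K3Index → ℂ)) (hσ : ∀ a b, k3Form (σ a) (σ b) = k3Form a b)
    (hσrat : ∀ v : K3Index → ℤ, ∃ w : K3Index → ℚ, σ (fun i => (v i : ℂ)) = fun i => (w i : ℂ))
    (heig : thetaC θ (σ x) = (e : ℂ) • σ x) :
    HodgeConjectureFor 4 (S ⊗ S) := by
  have he : e ≠ 0 := fun h0 => hirr 0 (by rw [h0, Rat.cast_zero, Complex.ofReal_zero])
  have hx0 : η.symm x ≠ 0 := fun h0 =>
    ne_zero_of_star_self_re_pos hM.2.2.2.1 (by simpa using congrArg η h0)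
  obtain ⟨Θ, hΘrat, hΘtyp, hΘcyc, hΘx⟩ :=
    exists_oneCycle_of_openAll hB hθsa he hπe hπW hOpen hS η p x hM σ hσ hσrat heig
  exact OneCycle.hodgeConjectureFor_square_of_oneCycle_of_picard hB hmark hS h2 h4 h6 h10
    complexOrientationFamily Θ hΘrat hΘtyp hΘcyc ⟨η.symm x, e, hM.2.1.2.2.2.2.1, hx0, hΘx, hirr⟩

/-- **(T⁗-ρ) BY NAME from a separable model polynomial without rational roots.** As
`hodgeConjectureFor_square_of_openAll_of_picard`, with the certificate AND the irrationality derived from a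
separable `P ∈ ℚ[X]` without rational roots satisfying the model identity `θ_ℂ·P(θ_ℂ) = 0` and an
eigenvalue `e ≠ 0`: `e` is a root of `P` (the period `σx ≠ 0` is an `e`-eigenvector), hence irrational.
CONDITIONAL on `Buskin2019_hodgeIsometry_algebraic`, `Huybrechts_K3_marking_exists` and the displayed
input; credits nothing; HC is NOT proved here. [cite: GeemenSchutt2023, §2.1 and §3.4] [cite: Buskin2019, Thm. 1.1]
[cite: Lang2002, Ch. XIV §2–§3] -/
theorem hodgeConjectureFor_square_of_openAll_of_picard_of_separable
    (hB : Buskin2019_hodgeIsometry_algebraic) (hmark : Huybrechts_K3_marking_exists)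
    {θ : Matrix K3Index K3Index ℚ}
    (hθsa : ∀ a b : K3Index → ℂ, k3Form (thetaC θ a) b = k3Form a (thetaC θ b))
    {e : ℝ} (he : e ≠ 0)
    {P : ℚ[X]} (hPsep : P.Separable) (hPno : ∀ a : ℚ, ¬ P.IsRoot a)
    (hθP : aeval (thetaC θ) (X * P.map (algebraMap ℚ ℂ)) = 0)
    (hOpen : OpenAll[θ, e])
    (hS : IsK3Surface S)
    (h2 : Module.finrank ℂ ↥(algebraicClasses S 1) ≠ 2) (h4 : Module.finrank ℂ ↥(algebraicClasses S 1) ≠ 4)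
    (h6 : Module.finrank ℂ ↥(algebraicClasses S 1) ≠ 6) (h10 : Module.finrank ℂ ↥(algebraicClasses S 1) ≠ 10)
    (η : complexBetti S (2 * 1) ≃ₗ[ℂ] (K3Index → ℂ)) (p : complexBetti S (2 * 2)) (x : K3Index → ℂ)
    (hM : MarkedK3[S, η, p, x])
    (σ : Module.End ℂ (K3Index → ℂ)) (hσ : ∀ a b, k3Form (σ a) (σ b) = k3Form a b)
    (hσrat : ∀ v : K3Index → ℤ, ∃ w : K3Index → ℚ, σ (fun i => (v i : ℂ)) = fun i => (w i : ℂ))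
    (heig : thetaC θ (σ x) = (e : ℂ) • σ x) :
    HodgeConjectureFor 4 (S ⊗ S) := by
  have he' : (e : ℂ) ≠ 0 := by exact_mod_cast he
  have hσx0 : σ x ≠ 0 := ne_zero_of_star_self_re_pos (periodPt_ratIsometry σ hσ hσrat hM.2.2).2.1
  set PC : ℂ[X] := P.map (algebraMap ℚ ℂ) with hPC
  have hroot : PC.IsRoot (e : ℂ) := by
    have h1 := LinearMap.congr_fun hθP (σ x)
    rw [LinearMap.zero_apply, aeval_apply_of_eigen heig, smul_eq_zero, Polynomial.eval_mul,
      Polynomial.eval_X, mul_eq_zero] at h1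
    rcases h1 with (h1 | h1) | h1
    · exact absurd h1 he'
    · exact h1
    · exact absurd h1 hσx0
  have hirr : ∀ a : ℚ, (a : ℂ) ≠ (e : ℂ) := by
    intro a ha
    apply hPno a
    have h1 : Polynomial.aeval (algebraMap ℚ ℂ a) P = 0 := by
      rw [eq_ratCast, ha, ← Polynomial.eval_map_algebraMap]
      exact hroot
    rw [Polynomial.aeval_algebraMap_apply_eq_algebraMap_eval, map_eq_zero_iff _ (algebraMap ℚ ℂ).injective] at h1
    exact h1
  obtain ⟨π, hπe, hπW⟩ := exists_eigenprojector_certificate (thetaC θ) (hPsep.map) hθP hroot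
  exact hodgeConjectureFor_square_of_openAll_of_picard hB hmark hθsa hirr hπe hπW hOpen hS h2 h4 h6 h10 η p x
    hM σ hσ hσrat heig

end Summit.HodgeConjecture.HodgeConjecture.Theorems.MarkmanPartnerTransport.RMTypeOrbit

end
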